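import Summits.BirchSwinnertonDyer.BirchSwinnertonDyer.Theorems.GenusKolyvaginAtTwoEquivariantKolyvaginExactAtTwoArchimedeanVanishingNegDisc
import Literature.NumberTheory.EllipticCurves.ArchimedeanLocalConditionTorsion
import HarnessLib

/-!
# Route `GenusKolyvaginAtTwo`, LINE 6, KEY crux Q3 (inner statement of stmt-BirchSwinnertonDyer-22137):
# `Δ(E) < 0` ⟹ the level-`n` Selmer condition at `∞` is vacuous for `E` and for every twist `E^{(d)}`
# (McCallum's Lemma 4.3 over `ℚ` at the real place — inputs `loc_c₁_inf` / `loc_c₂_inf` of the pair instance)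

Helper (seat `bsd-line-gk2-p3` g12; `--supports` the crux, closes nothing). This lineage's
`…ArchimedeanVanishingNegDisc` (g10, p616046 ff.) proved `H¹(ℚ_∞, E(ℚ̄_∞)) = 0` on the habitat `Δ(E) < 0` and the
vacuity of the `p^∞`-Selmer condition at `∞`. The pair descent at `2` over `ℚ` (`…VisiblePairAtTwoDefs`, input record
`Input`, fields `loc_c₁_inf`, `loc_c₂_inf`) needs the FINITE-LEVEL statement: for every `n : ℤ`,

* `selmerLocalKer_infinitePlace_eq_top_of_Δ_neg` — **`selmerLocalKer W ℚ_∞ n = ⊤`** (the level-`n` condition is the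
  preimage of the `H¹(·, E)` condition, tree `mem_selmerLocalKer_iff_torsionH1ToH1_mem`, and the latter is `⊤`,
  `localRestrictionKer_infinitePlace_eq_top_of_Δ_neg`);
* `selmerLocalKer_infinitePlace_quadraticTwist_eq_top_of_Δ_neg` — the same for `E^{(d)}`, `d ≠ 0`
  (`Δ(E^{(d)}) = d⁶Δ(E) < 0`); in particular for the twin `E^{(d_K)}`.

So on the habitat the real place contributes NO hypothesis to Lemma 4.3 over `ℚ` for either member of the pair.
THEOREMS ONLY (no definition, no named fact, no `sorry`, standard axioms). BSD is not proved by any of this.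

References: [GrossLMS1991] §6 (proof of Prop. 6.2 (1)); [MilneADT2006] I Rem. 3.7; [McCallumLMS1991] §4 Lemma 4.3;
[SilvermanAEC2009] X.§2, X.5 Cor. 5.4.
-/

set_option autoImplicit false
set_option linter.dupNamespace false -- tree convention: `Summit.BirchSwinnertonDyer.BirchSwinnertonDyer.Theorems` (summit = sub-problem)

noncomputable section

open scoped Classical

namespace Summit.BirchSwinnertonDyer.BirchSwinnertonDyer.Theorems.GenusExact.ArchVanishing

open WeierstrassCurve NumberField Field
open Literature.NumberTheory.EllipticCurves Literature.NumberTheory.GaloisRepresentations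

variable (W : WeierstrassCurve ℚ) [W.IsElliptic] (w : InfinitePlace ℚ)

/-- **`Δ(E) < 0` ⟹ the level-`n` Selmer local condition at `∞` is vacuous**: `selmerLocalKer W ℚ_∞ n = ⊤` for every
`n : ℤ`. [cite: GrossLMS1991, §6 (proof of Prop. 6.2 (1))] [cite: MilneADT2006, I Rem. 3.7] -/
theorem selmerLocalKer_infinitePlace_eq_top_of_Δ_neg (hΔ : W.Δ < 0) (n : ℤ) :
    selmerLocalKer W w.Completion n = ⊤ := by
  rw [eq_top_iff]
  intro c _
  rw [mem_selmerLocalKer_iff_torsionH1ToH1_mem, localRestrictionKer_infinitePlace_eq_top_of_Δ_neg W w hΔ]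
  trivial

/-- **… and for every quadratic twist `E^{(d)}`, `d ≠ 0`** (`Δ(E^{(d)}) = d⁶ Δ(E) < 0`); in particular for the twin
`E^{(d_K)}` of the pair descent. [cite: SilvermanAEC2009, X.5 Cor. 5.4] [cite: MilneADT2006, I Rem. 3.7] -/
theorem selmerLocalKer_infinitePlace_quadraticTwist_eq_top_of_Δ_neg (hΔ : W.Δ < 0) {d : ℚ} (hd : d ≠ 0)
    (n : ℤ) : selmerLocalKer (W.quadraticTwist d) w.Completion n = ⊤ := by
  haveI : (W.quadraticTwist d).IsElliptic := W.isElliptic_quadraticTwist hd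
  refine selmerLocalKer_infinitePlace_eq_top_of_Δ_neg (W.quadraticTwist d) w ?_ n
  rw [quadraticTwist_Δ]
  exact mul_neg_of_pos_of_neg (by positivity) hΔ

/-- Pointwise form (the shape of the inputs `loc_c₁_inf` / `loc_c₂_inf` of `…VisiblePairAtTwoDefs.Input`): on the
habitat every class of `E` and of `E^{(d)}` satisfies the Selmer condition at `∞`. [cite: MilneADT2006, I Rem. 3.7] -/
theorem mem_selmerLocalKer_infinitePlace_of_Δ_neg (hΔ : W.Δ < 0) (n : ℤ) (c : galH1Torsion W n) :
    c ∈ selmerLocalKer W w.Completion n := by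
  rw [selmerLocalKer_infinitePlace_eq_top_of_Δ_neg W w hΔ n]
  trivial

/-- Pointwise form for the twist. [cite: MilneADT2006, I Rem. 3.7] -/
theorem mem_selmerLocalKer_infinitePlace_quadraticTwist_of_Δ_neg (hΔ : W.Δ < 0) {d : ℚ} (hd : d ≠ 0)
    (n : ℤ) (c : galH1Torsion (W.quadraticTwist d) n) :
    c ∈ selmerLocalKer (W.quadraticTwist d) w.Completion n := by
  rw [selmerLocalKer_infinitePlace_quadraticTwist_eq_top_of_Δ_neg W w hΔ hd n]
  trivial

end Summit.BirchSwinnertonDyer.BirchSwinnertonDyer.Theorems.GenusExact.ArchVanishing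

end
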